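import Summits.CriticalPhenomena.CardyFormulaZ2.Theses.CardySelfRefinement
import Summits.CriticalPhenomena.CardyFormulaZ2.Theorems.CardySelfRefinementLagHandOffQuadCompactness
import Summits.CriticalPhenomena.CardyFormulaZ2.Theorems.LagHandOff.Negative.Structure
import Literature.Probability.Percolation.QuadCrossingSubseqLimits
import Mathlib.MeasureTheory.Function.ContinuousMapDense
import HarnessLib

/-!
# `LagHandOff` (stmt-CriticalPhenomena-10268), line `crosscut-dictionary`, STUB 2: two hands-offs
# to ONE Borel reading MERGE pathwise — the certified necessary condition NC1

Lemmas of the standing adversary (refuter `cdisprove`, cycle 4) isolating a falsifiable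
consequence of the load-bearing stub `stub_crosscutDictionary` (its `handsOff` field, verbatim
the hypothesis `h3` of `stub_freeAxioms` / `stub_markovPassage`): the bond-`ℤ²` interfaces of
EVERY admissible discretisation family of a Dobrushin domain hand off JOINTLY with the full-plane
quad configuration to one Borel reading `Ψ D`.

* `tendsto_integral_abs_sub_of_two_graph_limits` — ABSTRACT MERGING: if `(Xₙ, Yₙ)` and
  `(Xₙ, Zₙ)` both converge in law to the graph law `(ξ, f ξ)` of ONE Borel map `f` (test
  functions: bounded continuous on the product), then `∫ |h(Yₙ) - h(Zₙ)| → 0` for every bounded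
  continuous `h` (approximate `h ∘ f` in `L¹(μ)` by a bounded continuous `u` —
  `Integrable.exists_boundedContinuous_integral_sub_le`, finite Borel measures on metrisable
  spaces are weakly regular —, test on `(x, y) ↦ |h y - u x|`, triangle inequality).
* `interfaces_merge_of_handsOff` — hence, under the hands-off hypothesis, for ONE Dobrushin
  domain `D` and TWO admissible families `E`, `E'`, along every quad-convergent positive null
  sequence `∫ |h (γ^{D,E}_{δₙ}) - h (γ^{D,E'}_{δₙ})| dPerc → 0`;
  `interfaces_merge_of_handsOff'` — and along EVERY positive null sequence (sub-subsequence
  argument through the landed quad compactness `exists_mem_subseqQuadLimits_tendsto_subseq`).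

So STUB 2 contains the lattice statement "the exploration interface is insensitive, in
probability and in the curve metric, to the `o(1)` freedom of admissible data (position of the
marked boundary edges `e_a`, `e_b`, dust in the arcs)".  Boundary-arm heuristics support it; a
domain with two admissible families whose interfaces keep apart would refute STUB 2 through these
lemmas.  No kill is claimed.  Work file: `Cruxes/LagHandOff/Disproof.lean`.
-/

noncomputable section

open MeasureTheory Filter Set Topology
open scoped BoundedContinuousFunction
open Literature.Probability.Percolation Literature.Probability.LatticeModels
open Literature.Probability.RandomPlanarGeometry Literature.Probability.Percolation.QuadCrossing
open Summit.CriticalPhenomena.CardyFormulaZ2.Theses.CardySelfRefinement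

namespace Summit.CriticalPhenomena.CardyFormulaZ2.Theorems.LagHandOff.Negative

/-! ### Abstract merging -/

/-- **Merging lemma (abstract).**  On a finite measure space let `Xₙ` be random elements of a
metrisable Borel space `X`, `Yₙ`, `Zₙ` random elements of a pseudo-metric space `Y`, all
measurable, and suppose BOTH pairs `(Xₙ, Yₙ)` and `(Xₙ, Zₙ)` converge in law (tested on bounded
continuous functions of the pair) to the graph law `(ξ, f ξ)`, `ξ ∼ μ`, of ONE Borel map
`f : X → Y`.  Then `Yₙ` and `Zₙ` merge: `∫ |h(Yₙ) - h(Zₙ)| → 0` for every bounded continuous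
`h : Y → ℝ`.  Proof: approximate `h ∘ f` in `L¹(μ)` by a bounded continuous `u`
(`Integrable.exists_boundedContinuous_integral_sub_le`, `μ` is weakly regular), test the joint
convergences on `(x, y) ↦ |h y - u x|`, and use the triangle inequality. [folklore] -/
theorem tendsto_integral_abs_sub_of_two_graph_limits {Ω X Y : Type*} [MeasurableSpace Ω]
    {P : Measure Ω} [IsFiniteMeasure P] [TopologicalSpace X] [TopologicalSpace.MetrizableSpace X]
    [SecondCountableTopology X] [MeasurableSpace X] [BorelSpace X] [PseudoMetricSpace Y]
    [MeasurableSpace Y] [OpensMeasurableSpace Y] {μ : Measure X} [IsFiniteMeasure μ]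
    {f : X → Y} (hf : Measurable f) {Xs : ℕ → Ω → X} {Ys Zs : ℕ → Ω → Y}
    (hX : ∀ n, Measurable (Xs n)) (hY : ∀ n, Measurable (Ys n)) (hZ : ∀ n, Measurable (Zs n))
    (hYc : ∀ G : (X × Y) →ᵇ ℝ,
      Tendsto (fun n => ∫ ω, G (Xs n ω, Ys n ω) ∂P) atTop (𝓝 (∫ x, G (x, f x) ∂μ)))
    (hZc : ∀ G : (X × Y) →ᵇ ℝ,
      Tendsto (fun n => ∫ ω, G (Xs n ω, Zs n ω) ∂P) atTop (𝓝 (∫ x, G (x, f x) ∂μ)))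
    (h : Y →ᵇ ℝ) :
    Tendsto (fun n => ∫ ω, |h (Ys n ω) - h (Zs n ω)| ∂P) atTop (𝓝 0) := by
  letI : MetricSpace X := TopologicalSpace.metrizableSpaceMetric X
  have hhf : Integrable (fun x => h (f x)) μ := by
    refine (integrable_const ‖h‖).mono' (h.continuous.measurable.comp hf).aestronglyMeasurable ?_
    exact Eventually.of_forall fun x => h.norm_coe_le_norm (f x)
  rw [Metric.tendsto_atTop]
  intro ε hε
  obtain ⟨u, hu, -⟩ := hhf.exists_boundedContinuous_integral_sub_le (ε := ε / 4) (by positivity)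
  -- the joint test function `(x, y) ↦ |h y - u x|`
  let G : (X × Y) →ᵇ ℝ := BoundedContinuousFunction.ofNormedAddCommGroup
    (fun p => |h p.2 - u p.1|)
    (continuous_abs.comp ((h.continuous.comp continuous_snd).sub (u.continuous.comp continuous_fst)))
    (‖h‖ + ‖u‖) (fun p => by
      rw [Real.norm_eq_abs, abs_abs]
      refine (abs_sub _ _).trans (add_le_add ?_ ?_)
      · simpa [Real.norm_eq_abs] using h.norm_coe_le_norm p.2
      · simpa [Real.norm_eq_abs] using u.norm_coe_le_norm p.1)
  have hG : ∀ p, G p = |h p.2 - u p.1| := fun p => rfl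
  have hsmall : ∫ x, G (x, f x) ∂μ ≤ ε / 4 := by
    simpa only [hG, Real.norm_eq_abs] using hu
  have hlt : ∫ x, G (x, f x) ∂μ < ε / 2 := by linarith
  have hYev : ∀ᶠ n in atTop, ∫ ω, G (Xs n ω, Ys n ω) ∂P < ε / 2 :=
    (hYc G).eventually (gt_mem_nhds hlt)
  have hZev : ∀ᶠ n in atTop, ∫ ω, G (Xs n ω, Zs n ω) ∂P < ε / 2 :=
    (hZc G).eventually (gt_mem_nhds hlt)
  obtain ⟨N, hN⟩ := eventually_atTop.1 (hYev.and hZev)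
  refine ⟨N, fun n hn => ?_⟩
  obtain ⟨h1, h2⟩ := hN n hn
  -- integrability of the bounded measurable integrands
  have hGY : Integrable (fun ω => G (Xs n ω, Ys n ω)) P := by
    refine (integrable_const ‖G‖).mono'
      (G.continuous.measurable.comp ((hX n).prodMk (hY n))).aestronglyMeasurable ?_
    exact Eventually.of_forall fun ω => G.norm_coe_le_norm _
  have hGZ : Integrable (fun ω => G (Xs n ω, Zs n ω)) P := by
    refine (integrable_const ‖G‖).mono'
      (G.continuous.measurable.comp ((hX n).prodMk (hZ n))).aestronglyMeasurable ?_
    exact Eventually.of_forall fun ω => G.norm_coe_le_norm _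
  have hdiff : Integrable (fun ω => |h (Ys n ω) - h (Zs n ω)|) P := by
    refine (integrable_const (‖h‖ + ‖h‖)).mono' ?_ ?_
    · exact (continuous_abs.measurable.comp ((h.continuous.measurable.comp (hY n)).sub
        (h.continuous.measurable.comp (hZ n)))).aestronglyMeasurable
    · refine Eventually.of_forall fun ω => ?_
      rw [Real.norm_eq_abs, abs_abs]
      refine (abs_sub _ _).trans (add_le_add ?_ ?_)
      · simpa [Real.norm_eq_abs] using h.norm_coe_le_norm (Ys n ω)
      · simpa [Real.norm_eq_abs] using h.norm_coe_le_norm (Zs n ω)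
  rw [Real.dist_0_eq_abs, abs_of_nonneg (integral_nonneg fun ω => abs_nonneg _)]
  calc ∫ ω, |h (Ys n ω) - h (Zs n ω)| ∂P
      ≤ ∫ ω, (G (Xs n ω, Ys n ω) + G (Xs n ω, Zs n ω)) ∂P := by
        refine integral_mono hdiff (hGY.add hGZ) fun ω => ?_
        change |h (Ys n ω) - h (Zs n ω)| ≤ |h (Ys n ω) - u (Xs n ω)| + |h (Zs n ω) - u (Xs n ω)|
        calc |h (Ys n ω) - h (Zs n ω)|
            ≤ |h (Ys n ω) - u (Xs n ω)| + |u (Xs n ω) - h (Zs n ω)| := abs_sub_le _ _ _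
          _ = |h (Ys n ω) - u (Xs n ω)| + |h (Zs n ω) - u (Xs n ω)| := by rw [abs_sub_comm (u _)]
    _ = (∫ ω, G (Xs n ω, Ys n ω) ∂P) + ∫ ω, G (Xs n ω, Zs n ω) ∂P := integral_add hGY hGZ
    _ < ε := by linarith


/-- Interfaces of a discretisation family are measurable at every positive mesh (the edge set of
`Ω_δ` is finite; `Negative.Structure.measurable_bondInterfaceIn`). [folklore] -/
theorem measurable_bondInterfaceIn_family {D : DobrushinDomain} {E : ℝ → DiscreteDobrushin}
    (hE : ZdDiscretisationFamily D E) {δ : ℝ} (hδ : 0 < δ) :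
    Measurable (bondInterfaceIn D (E δ)) := by
  refine measurable_bondInterfaceIn D (E δ) ?_
  have hV : (meshDomain (E δ).Ω (E δ).δ).Finite := hE.meshDomain_finite hδ
  refine ((hV.prod hV).image (fun p : Site 2 × Site 2 => s(p.1, p.2))).subset ?_
  intro e he
  induction e using Sym2.ind with
  | _ x y =>
    have hadj := (SimpleGraph.mem_edgeSet _).1 he
    have h := discreteDomainGraph_adj_iff.1 hadj
    exact ⟨(x, y), ⟨h.2.1, h.2.2⟩, rfl⟩

/-- **NC1 along a quad-convergent sequence (certified consequence of STUB 2).**  If a Borel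
reading `Ψ` receives the joint hand-off of the interfaces of EVERY admissible discretisation
family (the `handsOff` field of `IsCrosscutDictionary`, here verbatim as hypothesis `h3` of
`stub_freeAxioms`), then for one Dobrushin domain `D` and TWO admissible families `E`, `E'` the
interfaces MERGE PATHWISE along every quad-convergent positive null sequence:
`∫ |h (γ^{D,E}_{δₙ}) - h (γ^{D,E'}_{δₙ})| dPerc → 0` for every bounded continuous `h`.  (So a
domain with two admissible families whose interfaces keep a distance in probability — e.g. a
persistent sensitivity of the exploration path to the `o(1)` position of the discrete marked
edges `e_a`, `e_b` — would refute STUB 2; boundary-arm heuristics say the sensitivity dies out, no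
kill is claimed.) [folklore] -/
theorem interfaces_merge_of_handsOff
    (Ψ : DobrushinDomain → QuadConfig (Set.univ : Set ℂ) → CurveClass ℂ)
    (h1 : ∀ D : DobrushinDomain, Measurable (Ψ D))
    (h3 : ∀ (μ : FiniteMeasure (QuadConfig (Set.univ : Set ℂ))) (δs : ℕ → ℝ), (∀ n, 0 < δs n) →
        Tendsto δs atTop (𝓝 0) →
        Tendsto (fun n => z2QuadLaw (Set.univ : Set ℂ) (δs n)) atTop (𝓝 μ) →
        ∀ (D : DobrushinDomain) (E : ℝ → DiscreteDobrushin), ZdDiscretisationFamily D E →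
          ∀ f : (QuadConfig (Set.univ : Set ℂ) × CurveClass ℂ) →ᵇ ℝ,
            Tendsto (fun n => ∫ ω, f (z2QuadConfig (Set.univ : Set ℂ) (δs n) ω,
                bondInterfaceIn D (E (δs n)) ω) ∂(bondPercolation (zdGraph 2) half))
              atTop (𝓝 (∫ S, f (S, Ψ D S) ∂(μ : Measure (QuadConfig (Set.univ : Set ℂ))))))
    {μ : FiniteMeasure (QuadConfig (Set.univ : Set ℂ))} {δs : ℕ → ℝ} (hpos : ∀ n, 0 < δs n)
    (hlim : Tendsto δs atTop (𝓝 0))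
    (hμ : Tendsto (fun n => z2QuadLaw (Set.univ : Set ℂ) (δs n)) atTop (𝓝 μ))
    (D : DobrushinDomain) {E E' : ℝ → DiscreteDobrushin} (hE : ZdDiscretisationFamily D E)
    (hE' : ZdDiscretisationFamily D E') (h : CurveClass ℂ →ᵇ ℝ) :
    Tendsto (fun n => ∫ ω, |h (bondInterfaceIn D (E (δs n)) ω) -
        h (bondInterfaceIn D (E' (δs n)) ω)| ∂(bondPercolation (zdGraph 2) half)) atTop (𝓝 0) := by
  obtain ⟨⟨hK, hM, hT⟩, -⟩ :=
    SchrammSmirnov2011_thm_1_4_holds (Set.univ : Set ℂ) isOpen_univ Set.univ_nonempty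
  haveI : CompactSpace (QuadConfig (Set.univ : Set ℂ)) := hK
  haveI : T2Space (QuadConfig (Set.univ : Set ℂ)) := hT
  haveI : TopologicalSpace.MetrizableSpace (QuadConfig (Set.univ : Set ℂ)) := hM
  haveI : SecondCountableTopology (QuadConfig (Set.univ : Set ℂ)) := by
    letI : MetricSpace (QuadConfig (Set.univ : Set ℂ)) := TopologicalSpace.metrizableSpaceMetric (QuadConfig (Set.univ : Set ℂ))
    exact EMetric.secondCountable_of_sigmaCompact (QuadConfig (Set.univ : Set ℂ))
  exact tendsto_integral_abs_sub_of_two_graph_limits (P := bondPercolation (zdGraph 2) half)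
    (μ := (μ : Measure (QuadConfig (Set.univ : Set ℂ)))) (h1 D)
    (fun n => measurable_z2QuadConfig isOpen_univ (hpos n))
    (fun n => measurable_bondInterfaceIn_family hE (hpos n))
    (fun n => measurable_bondInterfaceIn_family hE' (hpos n))
    (h3 μ δs hpos hlim hμ D E hE) (h3 μ δs hpos hlim hμ D E' hE') h

/-- **NC1 along the full filter `δ → 0⁺` (certified consequence of STUB 2).**  Under the same
hands-off hypothesis the interfaces of two admissible families of one domain merge along EVERY
positive null mesh sequence — no subsequence: every subsequence has a quad-convergent
sub-subsequence (`exists_mem_subseqQuadLimits_tendsto_subseq`, the landed STUB 1) along which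
`interfaces_merge_of_handsOff` applies, and `tendsto_of_subseq_tendsto` concludes. [folklore] -/
theorem interfaces_merge_of_handsOff'
    (Ψ : DobrushinDomain → QuadConfig (Set.univ : Set ℂ) → CurveClass ℂ)
    (h1 : ∀ D : DobrushinDomain, Measurable (Ψ D))
    (h3 : ∀ (μ : FiniteMeasure (QuadConfig (Set.univ : Set ℂ))) (δs : ℕ → ℝ), (∀ n, 0 < δs n) →
        Tendsto δs atTop (𝓝 0) →
        Tendsto (fun n => z2QuadLaw (Set.univ : Set ℂ) (δs n)) atTop (𝓝 μ) →
        ∀ (D : DobrushinDomain) (E : ℝ → DiscreteDobrushin), ZdDiscretisationFamily D E →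
          ∀ f : (QuadConfig (Set.univ : Set ℂ) × CurveClass ℂ) →ᵇ ℝ,
            Tendsto (fun n => ∫ ω, f (z2QuadConfig (Set.univ : Set ℂ) (δs n) ω,
                bondInterfaceIn D (E (δs n)) ω) ∂(bondPercolation (zdGraph 2) half))
              atTop (𝓝 (∫ S, f (S, Ψ D S) ∂(μ : Measure (QuadConfig (Set.univ : Set ℂ))))))
    {δs : ℕ → ℝ} (hpos : ∀ n, 0 < δs n) (hlim : Tendsto δs atTop (𝓝 0))
    (D : DobrushinDomain) {E E' : ℝ → DiscreteDobrushin} (hE : ZdDiscretisationFamily D E)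
    (hE' : ZdDiscretisationFamily D E') (h : CurveClass ℂ →ᵇ ℝ) :
    Tendsto (fun n => ∫ ω, |h (bondInterfaceIn D (E (δs n)) ω) -
        h (bondInterfaceIn D (E' (δs n)) ω)| ∂(bondPercolation (zdGraph 2) half)) atTop (𝓝 0) := by
  refine tendsto_of_subseq_tendsto fun ns hns => ?_
  obtain ⟨φ, hφ, μ, -, hμ⟩ :=
    Cruxes.LagHandOff.CrosscutDictionary.exists_mem_subseqQuadLimits_tendsto_subseq (δs ∘ ns)
      (fun n => hpos (ns n)) (hlim.comp hns)
  refine ⟨φ, ?_⟩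
  exact interfaces_merge_of_handsOff Ψ h1 h3 (δs := δs ∘ ns ∘ φ) (fun n => hpos _)
    ((hlim.comp hns).comp hφ.tendsto_atTop) hμ D hE hE' h

end Summit.CriticalPhenomena.CardyFormulaZ2.Theorems.LagHandOff.Negative

end
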